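import Mathlib
import Summits.AtomisticToContinuum.HydrodynamicLimit.Theorems.ImplosionDichotomyDenseExcursionSonicSlavingAnalyticProfile
import Summits.AtomisticToContinuum.HydrodynamicLimit.Theorems.ImplosionDichotomyDenseExcursionSonicSlavingAnalyticBranch
import Summits.AtomisticToContinuum.HydrodynamicLimit.Theorems.ImplosionDichotomyDenseExcursionSonicSlavingBranchUnique

/-!
# Smooth radial modes are analytic at the repulsive sonic point
# (crux `DenseExcursion`, line `sonic-cavity-renewal` v6, brick (M3) for the registered helper `sonicSlaving_of_tube`)

Helper file (`--supports stmt-AtomisticToContinuum-12586`, line lead a2, stub-worker W2 for `sonicSlaving_of_tube`).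

`smoothMode_analyticAt_sonic` (registered helper): for a monatomic profile in the cavity tube and `Im Λ ≠ 0`, every smooth radial mode
`(ŵ, ŝ)` is, on some interval `|x| < δ`, the real trace of a pair of HOLOMORPHIC functions on the complex disc `‖z‖ < δ`. Assembly of
the three bricks of the worker report `work/stubs/W2_sonicSlaving.REPORT.md` §3 (M3):
(1) `cavityTube_complex_extension` — the profile is holomorphic on `‖z‖ < 1/10` with the right real trace;
(2) `analyticBranch_char_system` — the complex characteristic system has a holomorphic solution `(P, M)` near `0` with `M 0 = ŵ 0 − 3ŝ 0`
    (non-resonant Frobenius theorem, `Im ν = −Im Λ/κ ≠ 0`);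
(3) `smoothBranch_eq_zero_near_sonic` — the difference of the mode and the real trace `((P + M)/2, (P − M)/6)` is a `C^∞` solution with
    `m(0) = 0`, hence vanishes near `0`.
This is the exact input "the smooth mode is bounded on a full complex neighbourhood of the sonic point" of the contour-transport route to
`SonicSlaving`, and the all-orders form of "the smooth mode equals the Frobenius series near `0`". No citation is load-bearing.
-/

noncomputable section

open Set Filter Metric
open scoped Topology ContDiff

namespace Summit.AtomisticToContinuum.HydrodynamicLimit.Theorems.SonicCavityRenewal

open Summit.AtomisticToContinuum.HydrodynamicLimit.Theorems.R2OneModeTwoConditions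

/-- THE MODE EQUATIONS FROM THE CHARACTERISTIC SYSTEM (converse of `mode_char_system`, same linear algebra): if at `x`
`c₊ (ŵ′ + 3ŝ′) = (Λ − b₊₊)(ŵ + 3ŝ) − b₊₋(ŵ − 3ŝ)` and `c₋ (ŵ′ − 3ŝ′) = −b₋₊(ŵ + 3ŝ) + (Λ − b₋₋)(ŵ − 3ŝ)`, then `Λ ŵ = linW`, `Λ ŝ = linS`
at `x`. [folklore] -/
theorem mode_of_char_system {r : ℝ} {W S : ℝ → ℝ} {Λ : ℂ} {ŵ ŝ : ℝ → ℂ} {x : ℝ}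
    (c1 : ((W x - 1 + S x : ℝ) : ℂ) * (deriv ŵ x + 3 * deriv ŝ x) =
        (Λ - ((2 / 3 * deriv W x + 2 * W x - r + 2 * deriv S x + 4 * S x : ℝ) : ℂ)) * (ŵ x + 3 * ŝ x) -
          ((deriv W x / 3 + deriv S x + 2 * S x : ℝ) : ℂ) * (ŵ x - 3 * ŝ x))
    (c2 : ((W x - 1 - S x : ℝ) : ℂ) * (deriv ŵ x - 3 * deriv ŝ x) =
        -((deriv W x / 3 - deriv S x - 2 * S x : ℝ) : ℂ) * (ŵ x + 3 * ŝ x) +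
          (Λ - ((2 / 3 * deriv W x + 2 * W x - r - 2 * deriv S x - 4 * S x : ℝ) : ℂ)) * (ŵ x - 3 * ŝ x)) :
    Λ * ŵ x = linW r W S ŵ ŝ x ∧ Λ * ŝ x = linS r W S ŵ ŝ x := by
  unfold linW linS
  push_cast at c1 c2 ⊢
  constructor
  · linear_combination (-(1 : ℂ) / 2) * c1 + (-(1 : ℂ) / 2) * c2
  · linear_combination (-(1 : ℂ) / 6) * c1 + ((1 : ℂ) / 6) * c2

/-- Linearity of `linW`, `linS` at a point where all four functions are differentiable. [folklore] -/
theorem lin_sub_at {r : ℝ} {W S : ℝ → ℝ} {ŵ ŝ ŵ' ŝ' : ℝ → ℂ} {x : ℝ} (hw : DifferentiableAt ℝ ŵ x)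
    (hs : DifferentiableAt ℝ ŝ x) (hw' : DifferentiableAt ℝ ŵ' x) (hs' : DifferentiableAt ℝ ŝ' x) :
    linW r W S (fun y => ŵ y - ŵ' y) (fun y => ŝ y - ŝ' y) x = linW r W S ŵ ŝ x - linW r W S ŵ' ŝ' x ∧
      linS r W S (fun y => ŵ y - ŵ' y) (fun y => ŝ y - ŝ' y) x = linS r W S ŵ ŝ x - linS r W S ŵ' ŝ' x := by
  unfold linW linS
  rw [deriv_fun_sub hw hw', deriv_fun_sub hs hs']
  constructor <;> ring

/-- The real trace of a holomorphic function is `C^∞`: if `P` is complex-differentiable on the disc `‖z‖ < δ` then `x ↦ P x` is `C^∞` on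
`(−δ, δ)`. [folklore] -/
theorem contDiffOn_realTrace {P : ℂ → ℂ} {δ : ℝ} (hP : DifferentiableOn ℂ P (ball 0 δ)) :
    ContDiffOn ℝ ∞ (fun x : ℝ => P x) (Ioo (-δ) δ) := by
  have h1 : ContDiffOn ℝ ∞ P (ball 0 δ) := (hP.contDiffOn isOpen_ball).restrict_scalars ℝ
  refine h1.comp Complex.ofRealCLM.contDiff.contDiffOn fun x hx => ?_
  exact ofReal_mem_ball_iff.2 (abs_lt.2 hx)

/-- The real trace has the complex derivative as its real derivative. [folklore] -/
theorem hasDerivAt_realTrace {P : ℂ → ℂ} {δ : ℝ} (hP : DifferentiableOn ℂ P (ball 0 δ)) {x : ℝ} (hx : |x| < δ) :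
    HasDerivAt (fun t : ℝ => P t) (deriv P x) x :=
  (hP.differentiableAt (isOpen_ball.mem_nhds (ofReal_mem_ball_iff.2 hx))).hasDerivAt.comp_ofReal

/-- **SMOOTH RADIAL MODES ARE ANALYTIC AT THE SONIC POINT** — registered helper `smoothMode_analyticAt_sonic` for
`sonicSlaving_of_tube`. For a monatomic profile in the cavity tube and `Im Λ ≠ 0`, every smooth radial mode `(ŵ, ŝ)` is, on some
interval `|x| < δ`, the real trace of holomorphic functions `F, G` on the disc `‖z‖ < δ`: `F x = ŵ x`, `G x = ŝ x`. (Complex extension of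
the profile + analytic branch of the characteristic system through `m(0) = ŵ 0 − 3ŝ 0` + local uniqueness of the smooth branch.) In
particular the smooth mode equals its Frobenius series near the sonic point, to all orders and uniformly on a full complex neighbourhood.
[folklore] -/
theorem smoothMode_analyticAt_sonic : ∀ (r : ℝ) (W S : ℝ → ℝ) (Λ : ℂ) (ŵ ŝ : ℝ → ℂ), IsMonatomicProfile r W S → CavityTube r W S → Λ.im ≠ 0 → IsSmoothRadialMode r W S Λ ŵ ŝ → ∃ δ : ℝ, 0 < δ ∧ ∃ F G : ℂ → ℂ, DifferentiableOn ℂ F (Metric.ball 0 δ) ∧ DifferentiableOn ℂ G (Metric.ball 0 δ) ∧ ∀ x : ℝ, |x| < δ → F (x : ℂ) = ŵ x ∧ G (x : ℂ) = ŝ x := by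
  intro r W S Λ ŵ ŝ hP hT hΛ hmode
  obtain ⟨Wc, Sc, hWa, hSa, htrace⟩ := cavityTube_complex_extension r W S hP hT
  obtain ⟨-, -, -, -, hSpos, -⟩ := id hP
  obtain ⟨h00, -, -, -, hκ, -, -, hcW, -⟩ := id hT
  obtain ⟨⟨hŵ, hŝ, -⟩, -, heq⟩ := hmode
  have hŵ1 : Differentiable ℝ ŵ := hŵ.differentiable (by simp)
  have hŝ1 : Differentiable ℝ ŝ := hŝ.differentiable (by simp)
  -- sonic data
  obtain ⟨hW0, hS0, hW1, hS1⟩ := htrace 0 (by norm_num)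
  have hcm : W 0 - 1 - S 0 ≠ 0 := by
    have h1 := (abs_le.1 (hcW 0 (by norm_num)).1).2
    have h2 := hSpos 0
    linarith
  have hκ' : deriv W 0 + deriv S 0 ≠ 0 := by linarith
  -- the analytic branch through `m(0)`
  obtain ⟨δ, hδ0, hδ10, P, M, hPd, hMd, hM0, hchar⟩ := analyticBranch_char_system Wc Sc (W 0) (S 0) (deriv W 0) (deriv S 0) r Λ
    (ŵ 0 - 3 * ŝ 0) hWa hSa (by simpa using hW0) (by simpa using hS0) (by simpa using hW1) (by simpa using hS1) h00 hκ' hcm hΛ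
  -- its real trace
  set wa : ℝ → ℂ := fun x => (P x + M x) / 2 with hwa
  set sa : ℝ → ℂ := fun x => (P x - M x) / 6 with hsa
  have hPr : ContDiffOn ℝ ∞ (fun x : ℝ => P x) (Ioo (-δ) δ) := contDiffOn_realTrace hPd
  have hMr : ContDiffOn ℝ ∞ (fun x : ℝ => M x) (Ioo (-δ) δ) := contDiffOn_realTrace hMd
  have hwaC : ContDiffOn ℝ ∞ wa (Ioo (-δ) δ) := (hPr.add hMr).div_const 2
  have hsaC : ContDiffOn ℝ ∞ sa (Ioo (-δ) δ) := (hPr.sub hMr).div_const 6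
  have hderiv : ∀ x : ℝ, |x| < δ → HasDerivAt wa ((deriv P x + deriv M x) / 2) x ∧ HasDerivAt sa ((deriv P x - deriv M x) / 6) x :=
    fun x hx => ⟨((hasDerivAt_realTrace hPd hx).add (hasDerivAt_realTrace hMd hx)).div_const 2,
      ((hasDerivAt_realTrace hPd hx).sub (hasDerivAt_realTrace hMd hx)).div_const 6⟩
  -- the real trace solves the mode equations on `(−δ, δ)`
  have hsol_a : ∀ x ∈ Ioo (-δ) δ, Λ * wa x = linW r W S wa sa x ∧ Λ * sa x = linS r W S wa sa x := by
    intro x hx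
    have hxa : |x| < δ := abs_lt.2 hx
    have hx10 : |x| < 1 / 10 := hxa.trans_le hδ10
    obtain ⟨eW, eS, edW, edS⟩ := htrace x hx10
    obtain ⟨e1, e2⟩ := hchar x (ofReal_mem_ball_iff.2 hxa)
    obtain ⟨dwa, dsa⟩ := hderiv x hxa
    have hp' : deriv wa x + 3 * deriv sa x = deriv P x := by rw [dwa.deriv, dsa.deriv]; ring
    have hm' : deriv wa x - 3 * deriv sa x = deriv M x := by rw [dwa.deriv, dsa.deriv]; ring
    have hp : wa x + 3 * sa x = P x := by simp only [hwa, hsa]; ring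
    have hm : wa x - 3 * sa x = M x := by simp only [hwa, hsa]; ring
    refine mode_of_char_system ?_ ?_
    · rw [hp', hp, hm]
      push_cast
      rw [← eW, ← eS, ← edW, ← edS]
      linear_combination e1
    · rw [hm', hp, hm]
      push_cast
      rw [← eW, ← eS, ← edW, ← edS]
      linear_combination e2
  -- the difference is a flat-able `C^∞` solution with `m(0) = 0`: it vanishes on `(−δ', δ')`, `δ' = min δ 1`
  set δ' : ℝ := min δ 1 with hδ'
  have hδ'0 : 0 < δ' := lt_min hδ0 one_pos
  have hδ'δ : δ' ≤ δ := min_le_left _ _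
  have hsubI : Ioo (-δ') δ' ⊆ Ioo (-δ) δ := Ioo_subset_Ioo (by linarith) hδ'δ
  have hdw : ContDiffOn ℝ ∞ (fun y => ŵ y - wa y) (Ioo (-δ') δ') := hŵ.contDiffOn.sub (hwaC.mono hsubI)
  have hds : ContDiffOn ℝ ∞ (fun y => ŝ y - sa y) (Ioo (-δ') δ') := hŝ.contDiffOn.sub (hsaC.mono hsubI)
  have hdsol : ∀ x ∈ Ioo (-δ') δ', Λ * (ŵ x - wa x) = linW r W S (fun y => ŵ y - wa y) (fun y => ŝ y - sa y) x ∧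
      Λ * (ŝ x - sa x) = linS r W S (fun y => ŵ y - wa y) (fun y => ŝ y - sa y) x := by
    intro x hx
    have hx' : x ∈ Ioo (-δ) δ := hsubI hx
    have hxa : |x| < δ := abs_lt.2 hx'
    obtain ⟨dwa, dsa⟩ := hderiv x hxa
    obtain ⟨l1, l2⟩ := lin_sub_at (r := r) (W := W) (S := S) (hŵ1 x) (hŝ1 x) dwa.differentiableAt dsa.differentiableAt
    obtain ⟨a1, a2⟩ := hsol_a x hx'
    obtain ⟨m1, m2⟩ := heq x
    rw [l1, l2]
    constructor
    · linear_combination m1 - a1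
    · linear_combination m2 - a2
  have hm00 : (ŵ 0 - wa 0) - 3 * (ŝ 0 - sa 0) = 0 := by
    have : wa 0 - 3 * sa 0 = M 0 := by simp only [hwa, hsa]; push_cast; ring
    rw [show (ŵ 0 - wa 0) - 3 * (ŝ 0 - sa 0) = (ŵ 0 - 3 * ŝ 0) - (wa 0 - 3 * sa 0) by ring, this, hM0]
    ring
  have hzero := smoothBranch_eq_zero_near_sonic r W S Λ (fun y => ŵ y - wa y) (fun y => ŝ y - sa y) δ' hP hT hΛ hδ'0
    (min_le_right _ _) hdw hds hdsol hm00
  -- conclusion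
  refine ⟨δ', hδ'0, fun z => (P z + M z) / 2, fun z => (P z - M z) / 6,
    ((hPd.add hMd).div_const 2).mono (ball_subset_ball hδ'δ), ((hPd.sub hMd).div_const 6).mono (ball_subset_ball hδ'δ),
    fun x hx => ?_⟩
  obtain ⟨h1, h2⟩ := hzero x (abs_lt.1 hx)
  exact ⟨(sub_eq_zero.1 h1).symm, (sub_eq_zero.1 h2).symm⟩

end Summit.AtomisticToContinuum.HydrodynamicLimit.Theorems.SonicCavityRenewal

end
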